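import Literature.AlgebraicGeometry.Motives.AbelianVarietyGoodReductionCofinite
import Literature.AlgebraicGeometry.Motives.AbelianVarietyTateSpecialisationOfReduction
import Literature.NumberTheory.DiophantineGeometry.AbelianSchemeModelReduction
import Literature.NumberTheory.GaloisRepresentations.DecompositionGroupOfCompletion
import Literature.NumberTheory.DiophantineGeometry.AbelianSchemeModelReductionTorsion
import Literature.NumberTheory.DiophantineGeometry.AbelianSchemeModelReductionInertia
import Literature.NumberTheory.DiophantineGeometry.AbelianSchemeModelReductionFrobenius
import Literature.NumberTheory.DiophantineGeometry.AbelianSchemeModelReductionNaturality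
import Literature.AlgebraicGeometry.Motives.TateModuleOfTorsionEquivs
import Literature.NumberTheory.DiophantineGeometry.AbelianSchemeModelReductionTorsionBijective
import HarnessLib

/-!
# The good-reduction datum of an abelian-scheme model together with its `ℓ`-adic specialisation datum
# (Serre–Tate 1968 §1; Bombieri–Gubler 10.3.9; Shimura 1998 §11.1 Props. 12, 14, §19.4)

Topic `Literature/AlgebraicGeometry/Motives`, namespace `Literature.AlgebraicGeometry.Motives.AbelianVariety`.
THEOREMS ONLY (no definition, no named fact, no instance).  Cell `hodgecm-mathlib` (D-0151), background programme
R-pkg (director BATCH 67, lead B-p20), piece **T7b = the ASSEMBLY**: for an abelian-scheme model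
`h : IsAbelianSchemeModel A v 𝒜` (Serre–Tate's «good reduction at v») the PRODUCED good-reduction datum `R` of
`Motives/AbelianVarietyGoodReductionCofinite` (model `𝒜` with generic isomorphism `h.exists_iso.choose`, reduction
`h.specialFibre`, `liftEnd` = the Néron extension, `redEnd` = its special fibre) CARRIES an `ℓ`-adic specialisation
datum `T : R.TateSpecialisation ℓ` along the prime `adicCompletionPrime K v` of `ℤ̄_K` with `T.equiv = T_ℓ(red_v)`,
`red_v = h.specialFibreReductionHom` the reduction map of `DiophantineGeometry/AbelianSchemeModelReduction` — GIVEN,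
as hypotheses in the exact shapes the R-pkg hands file (T1/T3: `T_ℓ(red_v)` bijective; T4: inertia of the prime fixes
the prime-to-`v` torsion; T5: (19.4a); T6′: `red_v` intertwines a model endomorphism with its two fibres), the four
geometric inputs.  When those four land as theorems the hypothesis-free corollary is a one-liner (same file, append).
HC_CM is proved only modulo the printed citations until rung 0 closes.
-/

noncomputable section

open CategoryTheory CategoryTheory.Limits AlgebraicGeometry IsDedekindDomain IsDedekindDomain.HeightOneSpectrum
  MonoidalCategory
open scoped MonObj NumberField CategoryTheory.Obj
open Literature.NumberTheory.EllipticCurves (genericFibre TateModule)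
open Literature.NumberTheory.DiophantineGeometry (IsAbelianSchemeModel specialFibreFunctor)
open Literature.NumberTheory.GaloisRepresentations

namespace Literature.AlgebraicGeometry.Motives

namespace AbelianVariety

variable {K : Type} [Field K] [NumberField K] {A : AbelianVariety K} {v : HeightOneSpectrum (𝓞 K)}
  {𝒜 : SchemeOver (valuationSubringAtPrime K v)} [GrpObj 𝒜]

/-- **The produced good-reduction datum of an abelian-scheme model carries an `ℓ`-adic specialisation datum along
`adicCompletionPrime K v`** (Serre–Tate §1 Lemma 2 / Thm. 1, Shimura Prop. 14 (i), (19.4a)), GIVEN the four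
geometric inputs of the R-pkg on the reduction map `red_v = h.specialFibreReductionHom`:
`hbij` (T1+T3: `T_ℓ(red_v)` is bijective), `hinert` (T4: the inertia group of `adicCompletionPrime K v` fixes the
`ℓ`-power torsion of `A(K̄)`), `hfrob` (T5: an arithmetic Frobenius at that prime reduces to `frobeniusHom`), and
`hend` (T6′: `red_v` intertwines every model endomorphism `F` of `𝒜` with its generic fibre `f` — read through the
model's chosen generic isomorphism `h.exists_iso.choose` — and its special fibre `r`).  The datum `R` is REBUILT here
exactly as in `exists_goodReductionAt_of_isAbelianSchemeModel` (Néron extension `L f`, special fibre `r f`), so that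
`R.redEnd f` is `r (L f)` by construction and `hend` applies.
[cite: SerreTate1968, §1 Lemma 2 and Thm. 1] [cite: Shimura1998, §11.1 Prop. 12, Prop. 14 (i); §19.4 (19.4a)]
[cite: BombieriGubler2006, 10.3.9 (p. 334)] -/
theorem exists_goodReductionAt_tateSpecialisation_of_isAbelianSchemeModel (h : IsAbelianSchemeModel A v 𝒜)
    (ℓ : ℕ) [Fact ℓ.Prime]
    (hbij : Function.Bijective (TateModule.map ℓ h.specialFibreReductionHom))
    (hinert : ∀ (n : ℕ) (σ : Field.absoluteGaloisGroup K),
      σ ∈ (adicCompletionPrime K v).inertia (Field.absoluteGaloisGroup K) →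
        ∀ x : A.geomPoints, x ∈ A.geomTorsion (ℓ ^ n : ℕ) → σ • x = x)
    (hfrob : ∀ (n : ℕ) (σ : Field.absoluteGaloisGroup K), IsArithFrobAt (𝓞 K) σ (adicCompletionPrime K v) →
      ∀ x : A.geomPoints, x ∈ A.geomTorsion (ℓ ^ n : ℕ) →
        h.specialFibreReductionHom (σ • x) =
          Hom.geomPointsMap (frobeniusHom h.specialFibre) (h.specialFibreReductionHom x))
    (hend : ∀ (F : 𝒜 ⟶ 𝒜) (f : End A) (r : h.specialFibre ⟶ h.specialFibre),
      (genericFibre (valuationSubringAtPrime K v) K).map F =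
          h.exists_iso.choose.hom ≫ f.hom.hom.hom ≫ h.exists_iso.choose.inv →
      r.hom.hom.hom = (specialFibreFunctor v).map F →
      ∀ (n : ℕ) (x : A.geomPoints), x ∈ A.geomTorsion (ℓ ^ n : ℕ) →
        h.specialFibreReductionHom (Hom.geomPointsMap (f : A ⟶ A) x) =
          Hom.geomPointsMap r (h.specialFibreReductionHom x)) :
    ∃ R : A.GoodReductionAt v, R.model.total = 𝒜 ∧ R.reduction = h.specialFibre ∧
      ∃ T : R.TateSpecialisation ℓ, T.prime = adicCompletionPrime K v := by
  classical
  -- the model's chosen generic isomorphism (the one `specialFibreReductionHom` is built with)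
  set e := h.exists_iso.choose with he_def
  haveI he : IsMonHom e.hom := h.exists_iso.choose_spec
  have hN := isNeronModel_of_isAbelianSchemeModel h
  haveI := h.isProper
  haveI := h.smooth
  haveI : Smooth 𝒜.hom := SmoothOfRelativeDimension.smooth A.dim 𝒜.hom
  haveI : IsSeparated 𝒜.hom := hN.isSeparated
  -- the Néron bijection `Hom_R(𝒜, 𝒜) ≃ Hom_K(𝒜_K, 𝒜_K)` at the smooth source `𝒜`
  have hNbij := hN.mappingProperty 𝒜 ‹Smooth 𝒜.hom›
  let Φ : (𝒜 ⟶ 𝒜) ≃ ((genericFibre (valuationSubringAtPrime K v) K).obj 𝒜 ⟶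
      (genericFibre (valuationSubringAtPrime K v) K).obj 𝒜) := Equiv.ofBijective _ hNbij
  -- the extension of the `K`-endomorphisms of `A`, transported along `e`
  let L : End A → (𝒜 ⟶ 𝒜) := fun f => Φ.symm (e.hom ≫ f.hom.hom.hom ≫ e.inv)
  have hL : ∀ f : End A, (genericFibre (valuationSubringAtPrime K v) K).map (L f) =
      e.hom ≫ f.hom.hom.hom ≫ e.inv := fun f => Φ.apply_symm_apply _
  have hinj : Function.Injective fun g : 𝒜 ⟶ 𝒜 => (genericFibre (valuationSubringAtPrime K v) K).map g :=
    hNbij.1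
  have hLmon : ∀ f : End A, IsMonHom (L f) := fun f => by
    haveI : IsMonHom ((genericFibre (valuationSubringAtPrime K v) K).map (L f)) := by
      rw [hL]; infer_instance
    exact isMonHom_of_isMonHom_genericFibre_map K 𝒜 (L f)
  have hL1 : L 1 = 𝟙 𝒜 := hinj (by
    change (genericFibre _ K).map (L 1) = (genericFibre _ K).map (𝟙 𝒜)
    rw [hL, CategoryTheory.Functor.map_id, End.one_def, AbelianVariety.id_hom, Grp.id_hom_hom]
    simp)
  have hLmul : ∀ f g : End A, L (f * g) = L g ≫ L f := fun f g => hinj (by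
    change (genericFibre _ K).map (L (f * g)) = (genericFibre _ K).map (L g ≫ L f)
    rw [CategoryTheory.Functor.map_comp, hL, hL, hL, End.mul_def, AbelianVariety.comp_hom, Grp.comp_hom_hom]
    simp)
  have hLadd : ∀ f g : End A, L (f + g) = L f * L g := fun f g => hinj (by
    change (genericFibre _ K).map (L (f + g)) = (genericFibre _ K).map (L f * L g)
    rw [Functor.map_mul, hL, hL, hL]
    change e.hom ≫ (f.hom * g.hom).hom.hom ≫ e.inv = _
    rw [Grp.Hom.hom_mul, Mon.Hom.hom_mul, MonObj.mul_comp, MonObj.comp_mul])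
  -- the reduction of endomorphisms: the special fibre of the extension
  let r : End A → End h.specialFibre := fun f =>
    haveI := hLmon f
    InducedCategory.homMk ((specialFibreFunctor v).mapGrp.map (Grp.ofHom (L f)))
  have hr : ∀ f, (r f).hom.hom.hom = (specialFibreFunctor v).map (L f) := fun f => rfl
  have hr1 : r 1 = 1 := by
    apply AbelianVariety.hom_ext
    rw [hr, hL1]
    change (specialFibreFunctor v).map (𝟙 𝒜) = 𝟙 ((specialFibreFunctor v).obj 𝒜)
    exact (specialFibreFunctor v).map_id _
  have hrmul : ∀ f g, r (f * g) = r f * r g := fun f g => by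
    apply AbelianVariety.hom_ext
    rw [End.mul_def (r f) (r g), hr, hLmul, CategoryTheory.Functor.map_comp]
    rfl
  have hradd : ∀ f g, r (f + g) = r f + r g := fun f g => by
    apply AbelianVariety.hom_ext
    rw [hr, hLadd]
    change (specialFibreFunctor v).map (L f * L g) =
      (specialFibreFunctor v).map (L f) * (specialFibreFunctor v).map (L g)
    exact Functor.map_mul (specialFibreFunctor v) (L f) (L g)
  let ρ : End A →+* End h.specialFibre :=
    RingHom.mk' { toFun := r, map_one' := hr1, map_mul' := hrmul } hradd
  let R : A.GoodReductionAt v :=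
    { model := ⟨𝒜, e⟩
      isSmoothProper := ⟨h.smooth, h.isProper⟩
      reduction := h.specialFibre
      reductionIso := Iso.refl _
      dim_reduction := dim_specialFibre_of_isAbelianSchemeModel h
      liftEnd := L
      liftEnd_left_comp := fun f => by
        have h1 : (genericFibre (valuationSubringAtPrime K v) K).map (L f) ≫ e.hom = e.hom ≫ f.hom.hom.hom := by
          rw [hL]; simp
        have h2 := congrArg CommaMorphism.left h1
        simp only [Over.comp_left] at h2
        exact h2
      redEnd := ρ
      redEnd_left_comp := fun f => by
        change ((specialFibreFunctor v).map (L f)).left ≫ 𝟙 _ = 𝟙 _ ≫ ((specialFibreFunctor v).map (L f)).left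
        simp }
  -- the `ℓ`-adic specialisation datum along `adicCompletionPrime K v` (T7a), `redEnd f = r (L f)` by construction
  obtain ⟨T, hT, -⟩ := GoodReductionAt.exists_tateSpecialisation_of_reductionMap R ℓ (adicCompletionPrime K v)
    (adicCompletionPrime_mem_primesAbove K v) h.specialFibreReductionHom hbij hinert hfrob
    (fun n f x hx => hend (L f) f (r f) (hL f) (hr f) n x hx)
  exact ⟨R, rfl, rfl, T, hT⟩

/-! ### Discharge of the four inputs by the R-pkg files (B-p07 T1, B-p09 T4, B-p12 T5, B-p19 T6′, A-p04 T3) -/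

omit [NumberField K] in
/-- `(ℓⁿ) ∉ v` from `(ℓ) ∉ v` (`v` is prime) — the hypothesis «`m` prime to the residue characteristic» of
Serre–Tate's Lemma 2 passes to powers. [cite: SerreTate1968, §1 Lemma 2] -/
private theorem natCast_pow_not_mem_of_not_mem {ℓ : ℕ} (hℓv : ((ℓ : ℕ) : 𝓞 K) ∉ v.asIdeal) (n : ℕ) :
    ((ℓ ^ n : ℕ) : 𝓞 K) ∉ v.asIdeal := fun hmem =>
  hℓv (v.isPrime.mem_of_pow_mem n (by rw [← Nat.cast_pow]; exact hmem))

/-- **The produced good-reduction datum carries an `ℓ`-adic specialisation datum along `adicCompletionPrime K v`,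
for `v ∤ ℓ`, GRANTED ONLY the injectivity of the reduction map on the `ℓ`-power torsion** (Serre–Tate §1 Lemma 2):
the inputs `hbij` (counting: B-p07 `specialFibreReductionHom_bijOn_geomTorsion_of_injOn` + A-p04
`tateModule_map_bijective_of_geomTorsion`), `hinert` (B-p09 `forall_smul_eq_self_of_mem_inertia_of_injOn`), `hfrob` (B-p12
`specialFibreReductionHom_smul_of_isArithFrobAt`) and `hend` (B-p19 `specialFibreReductionHom_geomPointsMap_end`) of
`exists_goodReductionAt_tateSpecialisation_of_isAbelianSchemeModel` are THEOREMS of the tree.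
[cite: SerreTate1968, §1 Lemma 2 and Thm. 1] [cite: Shimura1998, §11.1 Prop. 14 (i); §19.4 (19.4a)] -/
theorem exists_goodReductionAt_tateSpecialisation_of_injOn (h : IsAbelianSchemeModel A v 𝒜)
    (ℓ : ℕ) [Fact ℓ.Prime] (hℓv : ((ℓ : ℕ) : 𝓞 K) ∉ v.asIdeal)
    (hinj : ∀ n : ℕ, Set.InjOn h.specialFibreReductionHom (A.geomTorsion (ℓ ^ n : ℕ) : Set A.geomPoints)) :
    ∃ R : A.GoodReductionAt v, R.model.total = 𝒜 ∧ R.reduction = h.specialFibre ∧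
      ∃ T : R.TateSpecialisation ℓ, T.prime = adicCompletionPrime K v :=
  exists_goodReductionAt_tateSpecialisation_of_isAbelianSchemeModel h ℓ
    (tateModule_map_bijective_of_geomTorsion h.specialFibreReductionHom hinj fun n =>
      (h.specialFibreReductionHom_bijOn_geomTorsion_of_injOn (natCast_pow_not_mem_of_not_mem hℓv n) (hinj n)).surjOn)
    (h.forall_smul_eq_self_of_mem_inertia_of_injOn ℓ hinj)
    (fun _ _ hσ x _ => h.specialFibreReductionHom_smul_of_isArithFrobAt hσ x)
    (fun F f r hF hr _ x _ => h.specialFibreReductionHom_geomPointsMap_end (f : A ⟶ A) F r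
      (by rw [hF, Category.assoc, Category.assoc, Iso.inv_hom_id, Category.comp_id]) hr x)

/-- **… GRANTED ONLY that `[ℓⁿ]` is unramified on the model** (BLR *Néron Models* 7.3/2: `[N]` is étale on an abelian
scheme for `N` invertible on the base): injectivity on the `ℓⁿ`-torsion is B-p07's section-rigidity theorem
`specialFibreReductionHom_injOn_geomTorsion_of_formallyUnramified`.  The unramifiedness itself (fibrewise, from
`etale_zsmul_id_holds` on the two fibres) is the R-pkg's last brick T1c; with it this theorem becomes hypothesis-free.
[cite: SerreTate1968, §1 Lemma 2 and Thm. 1] [cite: BLRNeronModels1990, §7.3 Lemma 2] -/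
theorem exists_goodReductionAt_tateSpecialisation_of_formallyUnramified (h : IsAbelianSchemeModel A v 𝒜)
    (ℓ : ℕ) [Fact ℓ.Prime] (hℓv : ((ℓ : ℕ) : 𝓞 K) ∉ v.asIdeal)
    (hunr : ∀ n : ℕ, FormallyUnramified (((𝟙 𝒜 : 𝒜 ⟶ 𝒜) ^ (ℓ ^ n)) : 𝒜 ⟶ 𝒜).left) :
    ∃ R : A.GoodReductionAt v, R.model.total = 𝒜 ∧ R.reduction = h.specialFibre ∧
      ∃ T : R.TateSpecialisation ℓ, T.prime = adicCompletionPrime K v :=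
  exists_goodReductionAt_tateSpecialisation_of_injOn h ℓ hℓv fun n =>
    h.specialFibreReductionHom_injOn_geomTorsion_of_formallyUnramified (ℓ ^ n) (hunr n)

/-! ### The hypothesis-free statements (B-p07's `specialFibreReductionHom_injOn_geomTorsion_pow`: `[ℓⁿ]` IS unramified on the
model) — RE-LANDED: these two declarations were accepted in p616904 and dropped again when the older append p615889 was
applied after it; nothing referenced them in between. -/

/-- **Serre–Tate §1 / Shimura Prop. 14 (i), (19.4a) for an ABELIAN-SCHEME MODEL — unconditional**: for
`h : IsAbelianSchemeModel A v 𝒜` and every prime `ℓ` with `(ℓ) ∉ v`, the produced good-reduction datum `R` of `A` at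
`v` (model `𝒜`, reduction `h.specialFibre`) carries an `ℓ`-adic specialisation datum along `adicCompletionPrime K v`.
All four inputs of `exists_goodReductionAt_tateSpecialisation_of_isAbelianSchemeModel` are tree theorems
(R-pkg: B-p07 T1, B-p09 T4, B-p12 T5, B-p19/B-p15 T6′, A-p04 T3, A-p14 fibrewise unramifiedness); this is the VI-NOS
record `GoodReductionAt.nonempty_tateSpecialisation` in the produced (abelian-scheme) currency.  (The NAMED datum with
the same content is `IsAbelianSchemeModel.tateSpecialisation`, module `AbelianSchemeModelTateSpecialisationFamily`.)
[cite: SerreTate1968, §1 Lemma 2 and Thm. 1] [cite: Shimura1998, §11.1 Prop. 14 (i); §19.4 (19.4a)] -/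
theorem exists_goodReductionAt_tateSpecialisation_of_isAbelianSchemeModel' (h : IsAbelianSchemeModel A v 𝒜)
    (ℓ : ℕ) [Fact ℓ.Prime] (hℓv : ((ℓ : ℕ) : 𝓞 K) ∉ v.asIdeal) :
    ∃ R : A.GoodReductionAt v, R.model.total = 𝒜 ∧ R.reduction = h.specialFibre ∧
      ∃ T : R.TateSpecialisation ℓ, T.prime = adicCompletionPrime K v :=
  exists_goodReductionAt_tateSpecialisation_of_injOn h ℓ hℓv (h.specialFibreReductionHom_injOn_geomTorsion_pow hℓv)

/-- **Good reduction (abelian-scheme model) ⇒ `T_ℓ A` is unramified at `v` for `v ∤ ℓ`** (Serre–Tate §1 Thm. 1, easy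
direction; Shimura Lemma 19.5), in the consumer shape of the cell's `h₁₂` (`TorsionReciprocityReductionInertia`):
there is a prime `𝔓 ∣ v` of `ℤ̄_K` (namely `adicCompletionPrime K v`) whose inertia group acts trivially on `T_ℓ A`
(B-p09's `exists_primesAbove_forall_inertia_tateRep_eq_one_of_injOn` with B-p07's injectivity).
[cite: SerreTate1968, §1 Thm. 1] [cite: Shimura1998, §19.4 Lemma 19.5] -/
theorem _root_.Literature.NumberTheory.DiophantineGeometry.IsAbelianSchemeModel.exists_primesAbove_forall_inertia_tateRep_eq_one
    (h : IsAbelianSchemeModel A v 𝒜) (ℓ : ℕ) [Fact ℓ.Prime] (hℓv : ((ℓ : ℕ) : 𝓞 K) ∉ v.asIdeal) :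
    ∃ 𝔓 ∈ v.primesAbove, ∀ σ ∈ 𝔓.inertia (Field.absoluteGaloisGroup K), A.tateRep ℓ σ = 1 :=
  h.exists_primesAbove_forall_inertia_tateRep_eq_one_of_injOn ℓ (h.specialFibreReductionHom_injOn_geomTorsion_pow hℓv)

end AbelianVariety

end Literature.AlgebraicGeometry.Motives

end
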